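import Mathlib.Analysis.InnerProductSpace.PiL2
import Literature.Geometry.DiscreteGeometry.KissingPatterns
import HarnessLib

/-!
# Open-hemisphere counts of the two close-packed shells: cuboctahedron `6`, anticuboctahedron `7`

HONEST FRAMING. Part of the venture `Summits/Ventures/Crystal3D` (cells `pub-crystal3d`,
`crystal3d-full`). Elementary finite geometry only; nothing here is a claim about
three-dimensional crystallization.

The **open-hemisphere count** of a finite set `S ⊆ ℝ³` in direction `e` is the number of `v ∈ S`
with `0 < ⟪e, v⟫` (for the contact shell of a ball: the number of its contacts lying strictly on
one side of the plane through its centre orthogonal to `e`).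

* `two_mul_card_filter_le_card_of_neg`, `two_mul_card_filter_inner_pos_le_card` — a centrally
  symmetric finite set (`v ∈ S → -v ∈ S`) has open-hemisphere count `≤ |S|/2` in every direction
  (pair `v` with `-v`).
* `card_filter_inner_pos_fccKissingPattern_le_six` — the FCC pattern (cuboctahedron, the twelve
  unit vectors `(±1,±1,0)/√2, …`, `fccKissingPattern`) is centrally symmetric, so **at most six**
  of its twelve points lie in any open hemisphere; the same for every image of it under an odd map
  (`card_filter_inner_pos_image_fccKissingPattern_le_six`: rotated / scaled copies such as the
  contact shells `2 • A '' fccKissingPattern`) and for every subset (truncated shells); six is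
  attained (`exists_card_filter_inner_pos_fccKissingPattern_eq_six`).
* `card_filter_inner_pos_hcpKissingPattern_le_seven`,
  `exists_card_filter_inner_pos_hcpKissingPattern_eq_seven` — the HCP pattern (anticuboctahedron,
  `hcpKissingPattern`) is NOT centrally symmetric: its maximal open-hemisphere count is **exactly
  seven**. Upper bound: the hexagonal layer is centrally symmetric (`≤ 3`), and among the six
  points of the two triangles every five contain four with a vanishing positive combination
  (`t_β + 2 t_γ + 2 t'_α + t'_β = 0` for each ordering `α, β, γ` of the coordinates), so at most
  four of them are strictly positive; seven is attained in direction `(-2,-1,3)`.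

These are the «12-vector lemma» asked for by the cell `crystal3d-full` (HOME/cf-p1/ROUTE.md
§18(a),(c), §22): in the height calibration `D(x) = Σ_i (6 − #lower contacts of i)` of the contact
deficiency `D = 6N − C`, balls with a (possibly truncated) cuboctahedral shell carry non-negative
charge for every generic height direction, while an hcp-shelled ball can carry charge `−1` (and
never less).

WHAT THIS IS NOT: not a statement about packings, ground states or Wulff shapes; not the one-sided
kissing number (`Literature/Geometry/DiscreteGeometry/OneSidedKissingNumberThree.lean`: closed
hemispheres, `≤ 9`, attained inside `fccKissingPattern`).
-/

noncomputable section

namespace Summit.Ventures.Crystal3D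

open Real RealInnerProductSpace Finset
open Literature.Geometry.DiscreteGeometry

/-! ## Centrally symmetric finite sets -/

/-- **Antipodal pairing, predicate form.** If `S` is centrally symmetric (`v ∈ S → -v ∈ S`) and a
property `p` never holds for both `v` and `-v`, then at most half of the points of `S` satisfy `p`:
negation maps `{v ∈ S | p v}` injectively into `{v ∈ S | ¬ p v}`. -/
theorem two_mul_card_filter_le_card_of_neg {α : Type*} [DecidableEq α] [InvolutiveNeg α]
    (S : Finset α) (hS : ∀ v ∈ S, -v ∈ S) (p : α → Prop) [DecidablePred p]
    (hp : ∀ v ∈ S, p v → ¬ p (-v)) : 2 * (S.filter p).card ≤ S.card := by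
  have hPM : (S.filter p).image (fun v => -v) ⊆ S.filter fun v => ¬ p v := by
    intro w hw
    obtain ⟨v, hv, rfl⟩ := mem_image.1 hw
    rw [mem_filter] at hv ⊢
    exact ⟨hS v hv.1, hp v hv.1 hv.2⟩
  have hcard : (S.filter p).card ≤ (S.filter fun v => ¬ p v).card :=
    calc (S.filter p).card = ((S.filter p).image fun v => -v).card :=
          (card_image_of_injective _ neg_injective).symm
      _ ≤ (S.filter fun v => ¬ p v).card := card_le_card hPM
  have h := card_filter_add_card_filter_not (s := S) p
  omega

/-- **Antipodal pairing.** A centrally symmetric finite set of a real inner product space has at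
most half of its points in any open hemisphere `0 < ⟪e, ·⟫` (since `⟪e, -v⟫ = -⟪e, v⟫`). -/
theorem two_mul_card_filter_inner_pos_le_card {V : Type*} [NormedAddCommGroup V]
    [InnerProductSpace ℝ V] [DecidableEq V] (S : Finset V) (hS : ∀ v ∈ S, -v ∈ S) (e : V) :
    2 * (S.filter fun v => 0 < ⟪e, v⟫).card ≤ S.card := by
  classical
  refine two_mul_card_filter_le_card_of_neg S hS _ fun v _ hv => ?_
  rw [inner_neg_right]
  linarith

/-- The image of a centrally symmetric finite set under an odd map (`f (-v) = -f v`; e.g. any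
linear map) is centrally symmetric. -/
theorem neg_mem_image_of_odd {α β : Type*} [DecidableEq β] [Neg α] [Neg β]
    {S : Finset α} (hS : ∀ v ∈ S, -v ∈ S) {f : α → β} (hf : ∀ v, f (-v) = -f v) :
    ∀ w ∈ S.image f, -w ∈ S.image f := by
  intro w hw
  obtain ⟨v, hv, rfl⟩ := mem_image.1 hw
  exact mem_image.2 ⟨-v, hS v hv, hf v⟩

/-! ## Integer bookkeeping for the two patterns -/

/-- `intVec` is odd (same as `Bulk/TwinJunctionAxes.intVec_neg`, to keep imports light). -/
private theorem neg_intVec_eq (v : Fin 3 → ℤ) : intVec (-v) = -intVec v := by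
  ext i; simp [intVec]

/-- The inner product of two integer points of `ℝ³` is the integer dot product. -/
theorem inner_intVec_intVec (v w : Fin 3 → ℤ) :
    ⟪intVec v, intVec w⟫ = ((v 0 * w 0 + v 1 * w 1 + v 2 * w 2 : ℤ) : ℝ) := by
  rw [EuclideanSpace.inner_eq_star_dotProduct]
  simp [dotProduct, Fin.sum_univ_three, intVec, mul_comm]

/-- In a scaled integer pattern `{v/√N}`, the sign of `⟪intVec e, ·⟫` is the sign of the integer
dot product with `e`: the open-hemisphere count of direction `intVec e` is the number of pattern
vectors `v` with `0 < e · v` — a decidable integer count. -/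
theorem card_filter_inner_pos_scaledPattern (S : Finset (Fin 3 → ℤ)) {N : ℕ} (hN : N ≠ 0)
    (e : Fin 3 → ℤ) :
    ((scaledPattern S N).filter fun w => 0 < ⟪intVec e, w⟫).card =
      (S.filter fun v => 0 < e 0 * v 0 + e 1 * v 1 + e 2 * v 2).card := by
  classical
  have hpos : (0 : ℝ) < (Real.sqrt N)⁻¹ := by positivity
  unfold scaledPattern
  rw [filter_image, card_image_of_injective _ (scaledPattern_map_injective hN)]
  congr 1
  refine filter_congr fun v _ => ?_
  rw [real_inner_smul_right, inner_intVec_intVec, mul_pos_iff_of_pos_left hpos]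
  exact_mod_cast Iff.rfl

/-- A vanishing integer combination `v₁ + 2v₂ + 2v₃ + v₄ = 0` gives a vanishing combination of
inner products with any `e`, for the scaled real copies `c • intVec vᵢ`. -/
theorem inner_combination_eq_zero (e : EuclideanSpace ℝ (Fin 3)) (c : ℝ) {v₁ v₂ v₃ v₄ : Fin 3 → ℤ}
    (h : v₁ + 2 • v₂ + 2 • v₃ + v₄ = 0) :
    ⟪e, c • intVec v₁⟫ + 2 * ⟪e, c • intVec v₂⟫ + 2 * ⟪e, c • intVec v₃⟫ + ⟪e, c • intVec v₄⟫
      = 0 := by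
  have hv : intVec v₁ + (2 : ℝ) • intVec v₂ + (2 : ℝ) • intVec v₃ + intVec v₄ = 0 := by
    ext i
    have hi := congrFun h i
    simp only [Pi.add_apply, Pi.smul_apply, Pi.zero_apply] at hi
    simp only [PiLp.add_apply, PiLp.smul_apply, intVec_apply, smul_eq_mul, PiLp.zero_apply]
    exact_mod_cast hi
  have hsum : c • intVec v₁ + (2 : ℝ) • (c • intVec v₂) + (2 : ℝ) • (c • intVec v₃) +
      c • intVec v₄ = 0 := by
    rw [smul_comm (2 : ℝ) c, smul_comm (2 : ℝ) c, ← smul_add, ← smul_add, ← smul_add, hv,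
      smul_zero]
  have := congrArg (fun w : EuclideanSpace ℝ (Fin 3) => ⟪e, w⟫) hsum
  simpa only [inner_add_right, inner_smul_right, inner_zero_right] using this

/-! ## The cuboctahedron (FCC pattern): at most six in every open hemisphere -/

/-- A scaled integer pattern `{v/√N : v ∈ S}` whose integer model `S` is closed under negation
is centrally symmetric.  (For `S = fccInt`, all permutations of `(±1, ±1, 0)`, this is the central
symmetry of the cuboctahedron `fccKissingPattern`; the anticuboctahedron `hcpInt` is not closed
under negation.) -/
theorem neg_mem_scaledPattern {S : Finset (Fin 3 → ℤ)} (hS : ∀ v ∈ S, -v ∈ S) (N : ℕ) :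
    ∀ w ∈ scaledPattern S N, -w ∈ scaledPattern S N := by
  classical
  unfold scaledPattern
  exact neg_mem_image_of_odd hS fun w => by simp only [neg_intVec_eq, smul_neg]

/-- **The FCC pattern is centrally symmetric**: `fccInt` is closed under negation (`decide`), hence
so is `fccKissingPattern = scaledPattern fccInt 2`. -/
theorem fccKissingPattern_centrallySymmetric :
    ∀ v ∈ fccKissingPattern, -v ∈ fccKissingPattern :=
  neg_mem_scaledPattern (S := fccInt) (by decide) 2

/-- **At most six of the twelve FCC neighbours lie in any open hemisphere**: for every `e ∈ ℝ³`,
`#{v ∈ fccKissingPattern | 0 < ⟪e, v⟫} ≤ 6`. -/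
theorem card_filter_inner_pos_fccKissingPattern_le_six (e : EuclideanSpace ℝ (Fin 3)) :
    (fccKissingPattern.filter fun v => 0 < ⟪e, v⟫).card ≤ 6 := by
  classical
  have h := two_mul_card_filter_inner_pos_le_card fccKissingPattern
    fccKissingPattern_centrallySymmetric e
  rw [card_fccKissingPattern] at h
  omega

/-- The same bound for every image of the FCC pattern under an odd map `f : ℝ³ → V`
(`f (-v) = -f v`), in particular under any linear map — e.g. the rotated and scaled copies
`2 • A '' fccKissingPattern` used for contact shells:
`#{w ∈ f '' fccKissingPattern | 0 < ⟪e, w⟫} ≤ 6`. -/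
theorem card_filter_inner_pos_image_fccKissingPattern_le_six {V : Type*} [NormedAddCommGroup V]
    [InnerProductSpace ℝ V] [DecidableEq V] {f : EuclideanSpace ℝ (Fin 3) → V}
    (hf : ∀ v, f (-v) = -f v) (e : V) :
    ((fccKissingPattern.image f).filter fun w => 0 < ⟪e, w⟫).card ≤ 6 := by
  classical
  have hsym := neg_mem_image_of_odd (S := fccKissingPattern)
    fccKissingPattern_centrallySymmetric hf
  have h := two_mul_card_filter_inner_pos_le_card (fccKissingPattern.image f) hsym e
  have h12 : (fccKissingPattern.image f).card ≤ 12 :=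
    card_image_le.trans (by rw [card_fccKissingPattern])
  omega

/-- Subsets inherit the bound: a set of some of the FCC neighbours (a TRUNCATED cuboctahedral
shell) has at most six points in any open hemisphere. -/
theorem card_filter_inner_pos_le_six_of_subset_fccKissingPattern {T : Finset (EuclideanSpace ℝ (Fin 3))}
    (hT : T ⊆ fccKissingPattern) (e : EuclideanSpace ℝ (Fin 3)) :
    (T.filter fun v => 0 < ⟪e, v⟫).card ≤ 6 := by
  classical
  exact (card_le_card (filter_subset_filter _ hT)).trans
    (card_filter_inner_pos_fccKissingPattern_le_six e)

/-- **Six is attained for the FCC pattern**: in direction `(3, 2, 1)` (orthogonal to none of the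
twelve vectors) exactly six FCC neighbours have positive inner product. -/
theorem exists_card_filter_inner_pos_fccKissingPattern_eq_six :
    ∃ e : EuclideanSpace ℝ (Fin 3), (fccKissingPattern.filter fun v => 0 < ⟪e, v⟫).card = 6 := by
  refine ⟨intVec ![3, 2, 1], ?_⟩
  rw [fccKissingPattern, card_filter_inner_pos_scaledPattern _ two_ne_zero]
  decide

/-! ## The anticuboctahedron (HCP pattern): exactly seven -/

/-- **At most seven, in the integer model.** For every `e ∈ ℝ³` and every scale `c`, at most seven
of the twelve vectors `c • intVec v`, `v ∈ hcpInt`, have `0 < ⟪e, ·⟫`.  The hexagonal layer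
`{v | v₀ + v₁ + v₂ = 0}` (six vectors) is centrally symmetric, contributing `≤ 3`; the two
triangles `(3,3,0), (3,0,3), (0,3,3)` and `(−1,−1,−4), (−1,−4,−1), (−4,−1,−1)` satisfy the six
relations `t_β + 2t_γ + 2t'_α + t'_β = 0` (`{α, β, γ} = {x, y, z}`), and a subset of the six
triangle vectors containing the support of none of them has at most four elements (`decide`). -/
theorem card_filter_inner_pos_hcpInt_le_seven (e : EuclideanSpace ℝ (Fin 3)) (c : ℝ) :
    (hcpInt.filter fun v => 0 < ⟪e, c • intVec v⟫).card ≤ 7 := by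
  classical
  set q : (Fin 3 → ℤ) → Prop := fun v => 0 < ⟪e, c • intVec v⟫ with hq
  have hneg : ∀ v, q v → ¬ q (-v) := by
    intro v hv hv'
    simp only [hq, neg_intVec_eq, smul_neg, inner_neg_right] at hv hv'
    linarith
  -- split the shell into the hexagonal layer and the two triangles
  have hsplit := card_filter_add_card_filter_not (s := hcpInt.filter q)
    (fun v => v 0 + v 1 + v 2 = 0)
  rw [filter_filter, filter_filter] at hsplit
  have hcommH : (hcpInt.filter fun v => q v ∧ v 0 + v 1 + v 2 = 0) =
      (hcpInt.filter fun v => v 0 + v 1 + v 2 = 0).filter q := by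
    rw [filter_filter]; exact filter_congr fun v _ => and_comm
  have hcommT : (hcpInt.filter fun v => q v ∧ ¬ v 0 + v 1 + v 2 = 0) =
      (hcpInt.filter fun v => ¬ v 0 + v 1 + v 2 = 0).filter q := by
    rw [filter_filter]; exact filter_congr fun v _ => and_comm
  rw [hcommH, hcommT] at hsplit
  -- hexagonal layer: centrally symmetric, six vectors
  have hHsym : ∀ v ∈ hcpInt.filter (fun v => v 0 + v 1 + v 2 = 0),
      -v ∈ hcpInt.filter (fun v => v 0 + v 1 + v 2 = 0) := by decide
  have hH6 : (hcpInt.filter fun v => v 0 + v 1 + v 2 = 0).card = 6 := by decide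
  have hHex : 2 * ((hcpInt.filter fun v => v 0 + v 1 + v 2 = 0).filter q).card ≤ 6 := by
    rw [← hH6]
    exact two_mul_card_filter_le_card_of_neg _ hHsym q fun v _ => hneg v
  -- triangles: the six relations forbid five positives
  have hcomb : ∀ Q ∈ (hcpInt.filter fun v => ¬ v 0 + v 1 + v 2 = 0).powerset,
      ¬ ({![3, 0, 3], ![3, 3, 0], ![-4, -1, -1], ![-1, -4, -1]} ⊆ Q) →
      ¬ ({![3, 3, 0], ![3, 0, 3], ![-4, -1, -1], ![-1, -1, -4]} ⊆ Q) →
      ¬ ({![0, 3, 3], ![3, 3, 0], ![-1, -4, -1], ![-4, -1, -1]} ⊆ Q) →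
      ¬ ({![3, 3, 0], ![0, 3, 3], ![-1, -4, -1], ![-1, -1, -4]} ⊆ Q) →
      ¬ ({![0, 3, 3], ![3, 0, 3], ![-1, -1, -4], ![-4, -1, -1]} ⊆ Q) →
      ¬ ({![3, 0, 3], ![0, 3, 3], ![-1, -1, -4], ![-1, -4, -1]} ⊆ Q) →
      Q.card ≤ 4 := by
    decide
  have hrel : ∀ v₁ v₂ v₃ v₄ : Fin 3 → ℤ, v₁ + 2 • v₂ + 2 • v₃ + v₄ = 0 →
      ¬ ({v₁, v₂, v₃, v₄} ⊆ (hcpInt.filter fun v => ¬ v 0 + v 1 + v 2 = 0).filter q) := by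
    intro v₁ v₂ v₃ v₄ h hsub
    have h0 := inner_combination_eq_zero e c h
    have h1 : q v₁ := (mem_filter.1 (hsub (by simp))).2
    have h2 : q v₂ := (mem_filter.1 (hsub (by simp))).2
    have h3 : q v₃ := (mem_filter.1 (hsub (by simp))).2
    have h4 : q v₄ := (mem_filter.1 (hsub (by simp))).2
    simp only [hq] at h1 h2 h3 h4
    linarith
  have hTri : ((hcpInt.filter fun v => ¬ v 0 + v 1 + v 2 = 0).filter q).card ≤ 4 :=
    hcomb _ (mem_powerset.2 (filter_subset _ _))
      (hrel _ _ _ _ (by decide)) (hrel _ _ _ _ (by decide)) (hrel _ _ _ _ (by decide))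
      (hrel _ _ _ _ (by decide)) (hrel _ _ _ _ (by decide)) (hrel _ _ _ _ (by decide))
  change (hcpInt.filter q).card ≤ 7
  omega

/-- **At most seven of the twelve HCP neighbours lie in any open hemisphere**: for every
`e ∈ ℝ³`, `#{v ∈ hcpKissingPattern | 0 < ⟪e, v⟫} ≤ 7`. -/
theorem card_filter_inner_pos_hcpKissingPattern_le_seven (e : EuclideanSpace ℝ (Fin 3)) :
    (hcpKissingPattern.filter fun v => 0 < ⟪e, v⟫).card ≤ 7 := by
  classical
  unfold hcpKissingPattern scaledPattern
  rw [filter_image, card_image_of_injective _ (scaledPattern_map_injective (by norm_num))]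
  exact card_filter_inner_pos_hcpInt_le_seven e _

/-- **Seven is attained for the HCP pattern.** In the integer model `hcpInt` (hexagonal layer
`x + y + z = 0`, upper triangle `3·{(1,1,0),(1,0,1),(0,1,1)}`, lower triangle its mirror image
`{(−1,−1,−4), (−1,−4,−1), (−4,−1,−1)}`), the direction `e = (−2, −1, 3)` is orthogonal to none of
the twelve vectors and has positive dot product with exactly seven of them (three of the hexagon,
the whole upper triangle, and `(−1,−4,−1)`).  So the anticuboctahedron is not centrally symmetric,
and an hcp-coordinated ball can have seven contacts strictly on one side of a plane through its
centre (six for fcc). -/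
theorem exists_card_filter_inner_pos_hcpKissingPattern_eq_seven :
    ∃ e : EuclideanSpace ℝ (Fin 3), (hcpKissingPattern.filter fun v => 0 < ⟪e, v⟫).card = 7 := by
  refine ⟨intVec ![-2, -1, 3], ?_⟩
  rw [hcpKissingPattern, card_filter_inner_pos_scaledPattern _ (by norm_num)]
  decide

end Summit.Ventures.Crystal3D

end
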